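import Literature.GroupTheory.CombinatorialGroupTheory.RandomSclFreeGroupBigCorners
import HarnessLib

/-!
# Random rigidity of scl (Calegari–Walker 2013): proofs, part 31 — the next big corner, the
partner corner and the previous big corner

D. Calegari, A. Walker, *Random rigidity in the free group*, Geom. Topol. 17 (2013)
[CalegariWalker2013], §4.4. With a gap function `g` (`g x` = length of the edge leaving the big
corner `x`, see `exists_gap`): `next x = σ^{g x} x` (the next big corner), `zcor x = σ^{−g x} (τ x)`
(the start corner of the partner side) and `prev y = zcor (τ⁻¹ y)`. We prove the identities
`g (zcor x) = g x`, `next (zcor x) = τ x`, `τ (zcor x) = next x`, `zcor (zcor x) = x`,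
`prev (next x) = x`, `next (prev y) = y`, bigness of all of these, and that `next` reaches every
big corner from every big corner.
-/

noncomputable section

namespace Literature.GroupTheory.CombinatorialGroupTheory

section NextBig

open Equiv

variable {N : ℕ} (π : Equiv.Perm (Fin N)) (hπ : ∀ y, π (π y) = y) (g : Fin N → ℕ)
  (hg : ∀ x, ((finRotate N).trans π) (((finRotate N).trans π) x) ≠ x →
    1 ≤ g x ∧ (∀ j, 1 ≤ j → j ≤ g x - 1 →
      ((finRotate N).trans π) (((finRotate N).trans π) (((finRotate N) ^ j) x)) = ((finRotate N) ^ j) x) ∧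
    ((finRotate N).trans π) (((finRotate N).trans π) (((finRotate N) ^ (g x)) x)) ≠ ((finRotate N) ^ (g x)) x)

include hπ hg

omit hπ hg in
/-- `τ x` is big when `x` is. [folklore] -/
theorem big_tau {x : Fin N} (hx : ((finRotate N).trans π) (((finRotate N).trans π) x) ≠ x) :
    ((finRotate N).trans π) (((finRotate N).trans π) (((finRotate N).trans π) x)) ≠
      ((finRotate N).trans π) x :=
  fun h => hx (((finRotate N).trans π).injective h)

omit hπ hg in
/-- `τ⁻¹ x` is big when `x` is. [folklore] -/
theorem big_tau_symm {x : Fin N} (hx : ((finRotate N).trans π) (((finRotate N).trans π) x) ≠ x) :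
    ((finRotate N).trans π) (((finRotate N).trans π) (((finRotate N).trans π).symm x)) ≠
      ((finRotate N).trans π).symm x := by
  intro h
  apply hx
  have := congrArg ((finRotate N).trans π) h
  rwa [Equiv.apply_symm_apply] at this

/-- **The partner corner is big.** [cite: CalegariWalker2013, §4.4] -/
theorem big_zcor {x : Fin N} (hx : ((finRotate N).trans π) (((finRotate N).trans π) x) ≠ x) :
    ((finRotate N).trans π) (((finRotate N).trans π)
      (((finRotate N).symm ^ (g x)) (((finRotate N).trans π) x))) ≠
      ((finRotate N).symm ^ (g x)) (((finRotate N).trans π) x) :=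
  big_partner_start π hπ x (g x) (hg x hx).1 (hg x hx).2.1 (hg x hx).2.2

/-- **The partner corner has the same gap.** [cite: CalegariWalker2013, §4.4] -/
theorem gap_zcor {x : Fin N} (hx : ((finRotate N).trans π) (((finRotate N).trans π) x) ≠ x) :
    g (((finRotate N).symm ^ (g x)) (((finRotate N).trans π) x)) = g x := by
  have hz := big_zcor π hπ g hg hx
  obtain ⟨h1, h2, h3⟩ := hg _ hz
  obtain ⟨p1, p2, p3⟩ := gap_partner π hπ x (g x) (hg x hx).1 hx (hg x hx).2.1
  refine gap_unique ((finRotate N).trans π) _ h1 h2 h3 (hg x hx).1 p1 ?_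
  rw [p2]; exact p3

/-- **`next (zcor x) = τ x`.** [cite: CalegariWalker2013, §4.4] -/
theorem next_zcor {x : Fin N} (hx : ((finRotate N).trans π) (((finRotate N).trans π) x) ≠ x) :
    ((finRotate N) ^ (g (((finRotate N).symm ^ (g x)) (((finRotate N).trans π) x))))
      (((finRotate N).symm ^ (g x)) (((finRotate N).trans π) x)) = ((finRotate N).trans π) x := by
  rw [gap_zcor π hπ g hg hx, pow_apply_symm_pow _ le_rfl, Nat.sub_self, pow_zero,
    Equiv.Perm.one_apply]

/-- **`τ (zcor x) = next x`.** [cite: CalegariWalker2013, §4.4] -/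
theorem tau_zcor {x : Fin N} (hx : ((finRotate N).trans π) (((finRotate N).trans π) x) ≠ x) :
    ((finRotate N).trans π) (((finRotate N).symm ^ (g x)) (((finRotate N).trans π) x)) =
      ((finRotate N) ^ (g x)) x :=
  tau_partner_start π hπ x (g x) (hg x hx).1 (hg x hx).2.1

omit hπ hg in
/-- `σ⁻ʲ (σʲ w) = w`. [folklore] -/
theorem symm_pow_apply_pow_self (j : ℕ) (w : Fin N) :
    ((finRotate N).symm ^ j) (((finRotate N) ^ j) w) = w := by
  induction j generalizing w with
  | zero => simp
  | succ j ih =>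
    rw [pow_succ, Equiv.Perm.mul_apply, pow_succ', Equiv.Perm.mul_apply, Equiv.symm_apply_apply,
      ih]

/-- **`zcor (zcor x) = x`.** [cite: CalegariWalker2013, §4.4] -/
theorem zcor_zcor {x : Fin N} (hx : ((finRotate N).trans π) (((finRotate N).trans π) x) ≠ x) :
    ((finRotate N).symm ^ (g (((finRotate N).symm ^ (g x)) (((finRotate N).trans π) x))))
      (((finRotate N).trans π) (((finRotate N).symm ^ (g x)) (((finRotate N).trans π) x))) = x := by
  rw [gap_zcor π hπ g hg hx, tau_zcor π hπ g hg hx, symm_pow_apply_pow_self]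

/-- **`prev (next x) = x`**, with `prev y = zcor (τ⁻¹ y)`. [cite: CalegariWalker2013, §4.4] -/
theorem prev_next {x : Fin N} (hx : ((finRotate N).trans π) (((finRotate N).trans π) x) ≠ x) :
    ((finRotate N).symm ^ (g (((finRotate N).trans π).symm (((finRotate N) ^ (g x)) x))))
      (((finRotate N).trans π) (((finRotate N).trans π).symm (((finRotate N) ^ (g x)) x))) = x := by
  rw [Equiv.apply_symm_apply]
  have h1 : ((finRotate N).trans π).symm (((finRotate N) ^ (g x)) x) =
      ((finRotate N).symm ^ (g x)) (((finRotate N).trans π) x) := by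
    rw [Equiv.symm_apply_eq]; exact (tau_zcor π hπ g hg hx).symm
  rw [h1, gap_zcor π hπ g hg hx, symm_pow_apply_pow_self]

/-- **`next (prev y) = y`** for a big `y`. [cite: CalegariWalker2013, §4.4] -/
theorem next_prev {y : Fin N} (hy : ((finRotate N).trans π) (((finRotate N).trans π) y) ≠ y) :
    ((finRotate N) ^ (g (((finRotate N).symm ^ (g (((finRotate N).trans π).symm y)))
        (((finRotate N).trans π) (((finRotate N).trans π).symm y)))))
      (((finRotate N).symm ^ (g (((finRotate N).trans π).symm y)))
        (((finRotate N).trans π) (((finRotate N).trans π).symm y))) = y := by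
  have hw := big_tau_symm π hy
  rw [Equiv.apply_symm_apply]
  have := next_zcor π hπ g hg hw
  rw [Equiv.apply_symm_apply] at this
  exact this

omit hπ in
/-- **`next` reaches every big corner.** For big `x, y` there is `k` with `next^[k] x = y`, and all
intermediate corners are big. [folklore] -/
theorem next_reaches (hN : 0 < N) {x y : Fin N}
    (hx : ((finRotate N).trans π) (((finRotate N).trans π) x) ≠ x)
    (hy : ((finRotate N).trans π) (((finRotate N).trans π) y) ≠ y) :
    ∃ k, (fun w => ((finRotate N) ^ (g w)) w)^[k] x = y := by
  -- strong induction on the cyclic distance from `x` to `y`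
  suffices h : ∀ (dist : ℕ) (x : Fin N), ((finRotate N).trans π) (((finRotate N).trans π) x) ≠ x →
      ((finRotate N) ^ dist) x = y → ∃ k, (fun w => ((finRotate N) ^ (g w)) w)^[k] x = y by
    -- the distance `(y + N - x) % N`
    have hd : ((finRotate N) ^ (((y : ℕ) + N - x) % N)) x = y := by
      apply Fin.ext
      rw [val_finRotate_pow hN, Nat.add_mod_mod, show (x : ℕ) + (y + N - x) = y + N by omega,
        Nat.add_mod_right, Nat.mod_eq_of_lt y.2]
    exact h _ x hx hd
  intro dist
  induction dist using Nat.strong_induction_on with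
  | _ dist ih =>
    intro x hx hxy
    rcases Nat.eq_zero_or_pos dist with h0 | hpos
    · subst h0; exact ⟨0, by simpa using hxy⟩
    obtain ⟨h1, h2, h3⟩ := hg x hx
    -- `g x ≤ dist` since `σ^dist x = y` is big
    have hle : g x ≤ dist := by
      by_contra hlt
      have := h2 dist hpos (by omega)
      rw [hxy] at this
      exact hy this
    rcases Nat.eq_or_lt_of_le hle with heq | hlt
    · refine ⟨1, ?_⟩
      simp only [Function.iterate_one]
      rw [heq]; exact hxy
    · -- recurse from `next x` at distance `dist - g x`
      have hnext : ((finRotate N) ^ (dist - g x)) (((finRotate N) ^ (g x)) x) = y := by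
        rw [← Equiv.Perm.mul_apply, ← pow_add, Nat.sub_add_cancel hle, hxy]
      obtain ⟨k, hk⟩ := ih (dist - g x) (by omega) _ h3 hnext
      exact ⟨k + 1, by rw [Function.iterate_succ_apply]; exact hk⟩

end NextBig

end Literature.GroupTheory.CombinatorialGroupTheory

end
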